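/-
Copyright: the b2b-balaban T⁴-continuum CRUX team, row NE7b OWNER lineage `t4-ne7b-p1` (gen 121). Project licence.
-/
import Summits.QuantumFields.BalabanUV.T4Continuum.Spine.NE7b.SupTorusComparisonDecay
import Summits.QuantumFields.BalabanUV.T4Continuum.Spine.NE7b.SupTorusMaximumPrinciple

/-!
# THE PROPAGATOR AND THE FLUCTUATION COVARIANCE DECAY POINTWISE ON THE STRICTLY CONVEX CLASS — `|H⁻¹f|(x) ≤ C‖f‖_∞e^{−δρ_s(bt x, y₀)}`
# (`V ≥ v₀ > 0`, constants from `(d, a, v₀)`) and `|Cf|(x) ≤ C‖f‖_∞e^{−δρ_s(bt x, y₀)}` (`v₀ ≤ V ≤ Λ`, constants from `(d, a, v₀, Λ)`) for a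
# source `f` in the block `y₀`, EVERY site, every mesh, every volume: (146)'s comparison decay fed with the block-mean letters of
# (138)∕(139) — the `ℓ^∞ → ℓ^∞`, block-to-site EXPONENTIAL LOCALITY of the torus road's propagator and covariance on this class;
# § [NE7bP1-G120-HANDOFF-FINAL] NEXT (3)(b) there is CLOSED (row NE7b, node U5c; (131)–(139), (144), (146) BY NAME; [folklore])

Cell `pub-balaban`, sub-cell `t4`, spine estimate NE7b (`T4WeightBudget.RelWeightBound`; the cell's OWN estimate — NOT PRINTED in
[Bałaban 1983–89], NOT PROVED).  Crux-route work under `Spine/NE7b/` by the row OWNER (`t4-ne7b-p1` gen 121, file (147)) under FREEZE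
(0)'s crux-prover clause; NOTHING of Bałaban's is named as a Lean object, valued or asserted; no `T4Continuum/Support` leaf typed; no `def`,
no notation (the action DISPLAYED; the fluctuation part WRITTEN OUT, `T⁻¹` Mathlib's inverse of `Matrix.of T`); zero `sorry`.  Imports (BY
NAME): the OWNER's (146) `…SupTorusComparisonDecay` (`pointwise_decay`), (144) `…SupTorusMaximumPrinciple` (`blockTerm_eq`,
`blockRMS_le_of_block_source`; through it (139) `coeff_le`, `covariance_local`, (138) `blockMean_le_of_block_source`, (135)
`nextScale_hessian_local`, (133) `action_sum_smul`, `action_sub`, (132) `isPseudoDist_torus`, (131) `exists_rate`, (89) TDF).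

WHY (located).  (146) `pointwise_decay`: on `V ≥ v₀ > 0`, `L_Vh = G` with `|G| ≤ Me^{−δ₁ρ_s(bt ·, y₀)}` forces `|h| ≤ CMe^{−δρ_s(bt ·, y₀)}`
pointwise.  For `u = H⁻¹f`, `L_Vu = f − a·(block means of u)`: `f` lives on the block `y₀` (`|f| ≤ M = Me^{−κ·0}`) and the block means decay
like `m_κ⁻¹e^{2dκ}Me^{−κρ_s}` ((138) with (144)'s `√((n+1)^{−d}Σf²) ≤ M`) — a decaying source.  For `Cf = u − h`, `h` the response part,
`L_V(u − h) = f − c∘bt` EXACTLY (zero block means, (139) `covariance_local` (ii)) with `|c| ≤ c₁m_κ⁻¹e^{2dκ}MK·e^{−δ′ρ_s}` ((139) `coeff_le`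
with (135)) — again a decaying source.  Rates: `κ` of (131); `δ′ = min(δ₁, κ∕2)`; the comparison rate `min(·, 1, v₀∕(4d+4))`.

WHAT IS PROVED ([folklore]; fine torus `Site d ((n+1)s)`, coarse `Site d s`, `[NeZero s]`; the action DISPLAYED; `bt x = σ_s(blk n (wm x))`;
`h = Σ_{y′}(Σ_{y″}T⁻¹(y′,y″)(n+1)^{−d}Σ_z u(σ(chart (wm y″) z)))ψ_{y′}`, `Hψ_{y′} = 𝟙[bt · = y′]`; `ρ_s` = (132)'s distance written out):
* §1 **`propagator_pointwise_decay`**: `∃ C δ > 0` from `(d, a, v₀)` only (`a > 0`, `v₀ > 0`) such that for ALL `n, s`, ALL `V ≥ v₀`, every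
  `y₀`, every `Hu = f` with `f` supported in the block `y₀`, `|f| ≤ M`, and EVERY site `x`: `|u x| ≤ C·M·e^{−δρ_s(bt x, y₀)}`.
* §2 **`covariance_pointwise_decay`**: `∃ C δ > 0` from `(d, a, v₀, Λ)` only such that for ALL `n, s`, ALL `v₀ ≤ V ≤ Λ`, ALL block columns
  `ψ`, every `y₀`, every `Hu = f` with `f` in the block `y₀`, `|f| ≤ M`, and EVERY site `x`: `|(u − h)(x)| ≤ C·M·e^{−δρ_s(bt x, y₀)}`.
* §3 toy.

HONEST (what this is NOT).  The STRICTLY CONVEX single-site class only (`V ≥ v₀ > 0`); the road's class `V ≥ −λ` of either sign stays at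
block-`ℓ²` ((138)∕(139)) — its pointwise theory needs potential theory not in the tree; sources in one block (general `f` by linearity);
`ℓ¹` circular geometry, cubic periods; constants explicit, far from sharp; scalar skeleton ((A3), NC-NE7b-α UNRULED); nothing of the
covariant propagators of [B4]–[B6]; nothing of Bałaban's.  BY-NAME EFFECT ON THE WALL: NONE.  NE7b NOT PRINTED ∕ NOT PROVED; spine
PROVED 0∕9; rung (B)+1 on a FINITE torus — NOT infinite volume, NOT the mass gap, NOT Clay.  HONEST DEPENDENCY: continuum YM on T⁴ ⇐
BetaPertH ∧ nine spine estimates (0∕9 proved); BetaPertH ⇐ (D1) ∧ (D4) ∧ CAP+tail; G-an2-4 gates asym, D1 and NE2∕3∕4.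
-/

set_option autoImplicit false

noncomputable section

namespace Summit.QuantumFields.BalabanUV.T4Continuum.NE7b.SupTorusPointwiseLocality

open Real
open Literature.MathematicalPhysics.QuantumFieldTheory.Balaban1983to89
open B6QGQLower276 (X e blk B side chart mem_B sum_B sum_B_const card_cube blk_chart)
open Beta (Site siteOf windowMap siteOf_windowMap siteOf_add)
open SupTorusDirichletForm (siteOf_chart_surjective blockOf_siteOf_of_mem)
open SupTorusHessianCombesThomas (exists_rate)
open SupTorusCoarseFloor (nextScale_hessian_local)
open SupTorusPropagatorLocality (blockMean_le_of_block_source)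
open SupTorusCovarianceLocality (coeff_le covariance_local)
open SupTorusMaximumPrinciple (blockTerm_eq blockRMS_le_of_block_source)
open SupTorusComparisonDecay (pointwise_decay)

variable {d : ℕ}

/-! ## §1. The unconstrained propagator decays POINTWISE from the source block, on the strictly convex class -/

/-- **`|H⁻¹f|(x) ≤ C·‖f‖_∞·e^{−δρ_s(bt x, y₀)}` ON THE STRICTLY CONVEX SINGLE-SITE CLASS `V ≥ v₀ > 0`, every mesh, every volume.**  Fix
`d`, `a > 0`, `v₀ > 0`.  THERE ARE `C, δ > 0` (functions of these only) such that for ALL `n, s`, ALL `V ≥ v₀`, every block `y₀`, every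
`u, f` with `Hu = f` (displayed action), `f` supported in the block `y₀` and `|f| ≤ M`, and EVERY fine site `x`: `|u x| ≤ C·M·e^{−δρ_s(bt x, y₀)}`.
`L_Vu = f − a·(block means of u)`: the source is `≤ M𝟙_{B_{y₀}} + a·m_κ⁻¹e^{2dκ}M·e^{−κρ_s(bt ·, y₀)}` by (138)∕(144), and (146)
`pointwise_decay` turns the decay of the source into decay of the solution — the `ℓ^∞ → ℓ^∞` block-to-site locality of `H⁻¹`, the object
§ NEXT (3)(b) asked for, on this class. [folklore] -/
theorem propagator_pointwise_decay (a : ℝ) (ha : 0 < a) {v₀ : ℝ} (hv₀ : 0 < v₀) :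
    ∃ C δ : ℝ, 0 < C ∧ 0 < δ ∧ ∀ (n s : ℕ) [NeZero s] (V : Site d ((n + 1) * s) → ℝ), (∀ x, v₀ ≤ V x) →
      ∀ (y₀ : Site d s) (M : ℝ) (u f : Site d ((n + 1) * s) → ℝ), (∀ x, siteOf d s (blk n (windowMap d ((n + 1) * s) x)) ≠ y₀ → f x = 0) →
      (∀ x, |f x| ≤ M) →
      (∀ x, ((n : ℝ) + 1) ^ 2 * ∑ μ, (2 * u x - u (x + siteOf d ((n + 1) * s) (e μ)) - u (x - siteOf d ((n + 1) * s) (e μ)))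
        + a / ((n : ℝ) + 1) ^ d * ∑ q ∈ B n (blk n (windowMap d ((n + 1) * s) x)), u (siteOf d ((n + 1) * s) q) + V x * u x = f x) →
      ∀ x : Site d ((n + 1) * s),
        |u x| ≤ C * M * exp (-(δ * ∑ i, ((((siteOf d s (blk n (windowMap d ((n + 1) * s) x))) i - y₀ i).valMinAbs.natAbs : ℕ) : ℝ))) := by
  classical
  have hd : (0 : ℝ) ≤ d := Nat.cast_nonneg d
  have hm0 : 0 < min 2 a - (-v₀) := by have : 0 ≤ min 2 a := le_min zero_le_two ha.le; linarith
  obtain ⟨κ, hκ0, hκ1, hκm⟩ := exists_rate (d := d) a ha.le hm0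
  have hm : 0 < min 2 a - (-v₀) - 2 * d * κ ^ 2 - a * (exp (2 * d * κ) - 1) := by linarith
  set m := min 2 a - (-v₀) - 2 * d * κ ^ 2 - a * (exp (2 * d * κ) - 1) with hm_def
  set δ : ℝ := min κ (min 1 (v₀ / (4 * d + 4))) with hδ_def
  have hδ0 : 0 < δ := lt_min hκ0 (lt_min one_pos (by positivity))
  have hδκ : δ ≤ κ := min_le_left _ _
  have hδ1 : δ ≤ 1 := (min_le_right _ _).trans (min_le_left _ _)
  have hδv : δ ≤ v₀ / (4 * d + 4) := (min_le_right _ _).trans (min_le_right _ _)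
  have hgap : 4 * d * δ ^ 2 ≤ v₀ := by
    have h1 : δ ^ 2 ≤ δ := by nlinarith
    have h2 : δ * (4 * d + 4) ≤ v₀ := by rwa [le_div_iff₀ (by positivity)] at hδv
    nlinarith
  have hminv : 0 ≤ m⁻¹ := inv_nonneg.2 hm.le
  refine ⟨2 * (1 + a * (m⁻¹ * exp (2 * d * κ))) * (4 : ℝ) ^ d * exp (2 * d) / v₀, δ, by positivity, hδ0, ?_⟩
  intro n s _ V hV y₀ M u f hf hfM hu x
  have hM : 0 ≤ M := (abs_nonneg _).trans (hfM x)
  have hVl : ∀ x, -(-v₀) ≤ V x := fun x => by linarith [hV x]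
  -- the source of `L_Vu`: `f − a·(block term)` decays like `e^{−κρ_s(bt ·, y₀)}`
  have hR := blockRMS_le_of_block_source n s y₀ f hf hfM
  have hG : ∀ x' : Site d ((n + 1) * s),
      |f x' - a / ((n : ℝ) + 1) ^ d * ∑ q ∈ B n (blk n (windowMap d ((n + 1) * s) x')), u (siteOf d ((n + 1) * s) q)|
        ≤ M * (1 + a * (m⁻¹ * exp (2 * d * κ)))
          * exp (-(κ * ∑ i, ((((siteOf d s (blk n (windowMap d ((n + 1) * s) x'))) i - y₀ i).valMinAbs.natAbs : ℕ) : ℝ))) := by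
    intro x'
    obtain ⟨⟨y, z⟩, hyz⟩ := siteOf_chart_surjective n s x'
    simp only at hyz
    have hblk : siteOf d s (blk n (windowMap d ((n + 1) * s) x')) = y := by
      rw [← hyz]; exact blockOf_siteOf_of_mem n s (mem_B.2 (blk_chart n (windowMap d s y) z))
    have hmean := blockMean_le_of_block_source n a s ha.le hκ0.le hκ1 hm V hVl y₀ u f hf hu y
    have hE := exp_pos (-(κ * ∑ i, (((y i - y₀ i).valMinAbs.natAbs : ℕ) : ℝ)))
    rw [hblk]
    -- `|f x'| ≤ M e^{−κρ}` (on the source block `ρ = 0`, off it `f = 0`)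
    have hf' : |f x'| ≤ M * exp (-(κ * ∑ i, (((y i - y₀ i).valMinAbs.natAbs : ℕ) : ℝ))) := by
      by_cases hx : siteOf d s (blk n (windowMap d ((n + 1) * s) x')) = y₀
      · have h0 : ∑ i, (((y i - y₀ i).valMinAbs.natAbs : ℕ) : ℝ) = 0 := by
          rw [← hblk, hx]; exact (SupTorusBlockDistance.isPseudoDist_torus (d := d) s).zero y₀
        rw [h0, mul_zero, neg_zero, exp_zero, mul_one]; exact hfM x'
      · rw [hf x' hx, abs_zero]; positivity
    have hB : |a / ((n : ℝ) + 1) ^ d * ∑ q ∈ B n (blk n (windowMap d ((n + 1) * s) x')), u (siteOf d ((n + 1) * s) q)|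
        ≤ a * (m⁻¹ * exp (2 * d * κ) * M) * exp (-(κ * ∑ i, (((y i - y₀ i).valMinAbs.natAbs : ℕ) : ℝ))) := by
      rw [← hyz, blockTerm_eq n s u y z, div_eq_mul_inv, mul_assoc, abs_mul, abs_of_pos ha, mul_assoc]
      refine mul_le_mul_of_nonneg_left (hmean.trans ?_) ha.le
      exact mul_le_mul_of_nonneg_right (mul_le_mul_of_nonneg_left hR (by positivity)) hE.le
    calc |f x' - a / ((n : ℝ) + 1) ^ d * ∑ q ∈ B n (blk n (windowMap d ((n + 1) * s) x')), u (siteOf d ((n + 1) * s) q)|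
        ≤ |f x'| + |a / ((n : ℝ) + 1) ^ d * ∑ q ∈ B n (blk n (windowMap d ((n + 1) * s) x')), u (siteOf d ((n + 1) * s) q)| := abs_sub _ _
      _ ≤ M * exp (-(κ * ∑ i, (((y i - y₀ i).valMinAbs.natAbs : ℕ) : ℝ)))
          + a * (m⁻¹ * exp (2 * d * κ) * M) * exp (-(κ * ∑ i, (((y i - y₀ i).valMinAbs.natAbs : ℕ) : ℝ))) := add_le_add hf' hB
      _ = _ := by ring
  have h := pointwise_decay n s hv₀ hδ0 hδ1 hδκ hgap V hV y₀ u
    (fun x' => f x' - a / ((n : ℝ) + 1) ^ d * ∑ q ∈ B n (blk n (windowMap d ((n + 1) * s) x')), u (siteOf d ((n + 1) * s) q))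
    hG (fun x' => by linarith [hu x']) x
  refine h.trans (mul_le_mul_of_nonneg_right ?_ (exp_pos _).le)
  have he : exp (2 * d * δ) ≤ exp (2 * d) := exp_le_exp.2 (by nlinarith)
  have h0 : 0 ≤ 2 * (M * (1 + a * (m⁻¹ * exp (2 * d * κ)))) * (4 : ℝ) ^ d := by positivity
  rw [div_le_iff₀ hv₀]
  have e1 : 2 * (1 + a * (m⁻¹ * exp (2 * d * κ))) * (4 : ℝ) ^ d * exp (2 * d) / v₀ * M * v₀
      = 2 * (M * (1 + a * (m⁻¹ * exp (2 * d * κ)))) * (4 : ℝ) ^ d * exp (2 * d) := by field_simp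
  rw [e1]
  nlinarith [mul_le_mul_of_nonneg_left he h0]

/-! ## §2. The fluctuation covariance decays POINTWISE from the source block, on the strictly convex two-sided class -/

/-- **`|Cf|(x) ≤ C·‖f‖_∞·e^{−δρ_s(bt x, y₀)}` ON THE STRICTLY CONVEX TWO-SIDED CLASS `v₀ ≤ V ≤ Λ`, every mesh, every volume.**  Fix
`d`, `a > 0`, `v₀ > 0`, `Λ ≥ 0`.  THERE ARE `C, δ > 0` (functions of these only) such that for ALL `n, s`, ALL `v₀ ≤ V ≤ Λ`, ALL block
columns `ψ` (`Hψ_{y′} = 𝟙[bt · = y′]`), every `y₀`, every `Hu = f` with `f` supported in the block `y₀`, `|f| ≤ M`, and EVERY site `x`: the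
fluctuation part `u − h`, `h = Σ_{y′}(Σ_{y″}T⁻¹(y′,y″)(n+1)^{−d}Σ_z u(σ(chart (wm y″) z)))ψ_{y′}` (`= Cf`), satisfies
`|(u − h)(x)| ≤ C·M·e^{−δρ_s(bt x, y₀)}` — `L_V(u − h) = f − c∘bt` has zero block-mean term ((139)) and a source decaying like the
coefficients `c` ((139) `coeff_le`); (146) `pointwise_decay` finishes. [folklore] -/
theorem covariance_pointwise_decay (a : ℝ) (ha : 0 < a) {v₀ Lam : ℝ} (hv₀ : 0 < v₀) (hLam : 0 ≤ Lam) :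
    ∃ C δ : ℝ, 0 < C ∧ 0 < δ ∧ ∀ (n s : ℕ) [NeZero s] (V : Site d ((n + 1) * s) → ℝ), (∀ x, v₀ ≤ V x) → (∀ x, V x ≤ Lam) →
      ∀ ψ : Site d s → Site d ((n + 1) * s) → ℝ,
      (∀ y' x, ((n : ℝ) + 1) ^ 2 * ∑ μ, (2 * ψ y' x - ψ y' (x + siteOf d ((n + 1) * s) (e μ)) - ψ y' (x - siteOf d ((n + 1) * s) (e μ)))
        + a / ((n : ℝ) + 1) ^ d * ∑ q ∈ B n (blk n (windowMap d ((n + 1) * s) x)), ψ y' (siteOf d ((n + 1) * s) q) + V x * ψ y' x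
        = if siteOf d s (blk n (windowMap d ((n + 1) * s) x)) = y' then 1 else 0) →
      ∀ (y₀ : Site d s) (M : ℝ) (u f : Site d ((n + 1) * s) → ℝ), (∀ x, siteOf d s (blk n (windowMap d ((n + 1) * s) x)) ≠ y₀ → f x = 0) →
      (∀ x, |f x| ≤ M) →
      (∀ x, ((n : ℝ) + 1) ^ 2 * ∑ μ, (2 * u x - u (x + siteOf d ((n + 1) * s) (e μ)) - u (x - siteOf d ((n + 1) * s) (e μ)))
        + a / ((n : ℝ) + 1) ^ d * ∑ q ∈ B n (blk n (windowMap d ((n + 1) * s) x)), u (siteOf d ((n + 1) * s) q) + V x * u x = f x) →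
      ∀ x : Site d ((n + 1) * s),
        |u x - ∑ y', (∑ y'', (Matrix.of fun yy y'' : Site d s =>
              (((n : ℝ) + 1) ^ d)⁻¹ * ∑ z : Fin d → Fin (n + 1), ψ y'' (siteOf d ((n + 1) * s) (chart n (windowMap d s yy) z)))⁻¹ y' y''
            * ((((n : ℝ) + 1) ^ d)⁻¹ * ∑ z'' : Fin d → Fin (n + 1), u (siteOf d ((n + 1) * s) (chart n (windowMap d s y'') z''))))
            * ψ y' x|
          ≤ C * M * exp (-(δ * ∑ i, ((((siteOf d s (blk n (windowMap d ((n + 1) * s) x))) i - y₀ i).valMinAbs.natAbs : ℕ) : ℝ))) := by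
  classical
  have hd : (0 : ℝ) ≤ d := Nat.cast_nonneg d
  have hm0 : 0 < min 2 a - (-v₀) := by have : 0 ≤ min 2 a := le_min zero_le_two ha.le; linarith
  obtain ⟨κ, hκ0, hκ1, hκm⟩ := exists_rate (d := d) a ha.le hm0
  have hm : 0 < min 2 a - (-v₀) - 2 * d * κ ^ 2 - a * (exp (2 * d * κ) - 1) := by linarith
  set m := min 2 a - (-v₀) - 2 * d * κ ^ 2 - a * (exp (2 * d * κ) - 1) with hm_def
  obtain ⟨c₁, δ₁, hc₁, hδ₁, H135⟩ := nextScale_hessian_local (d := d) a ha hm0 hLam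
  obtain ⟨C9, δ9, -, -, H139⟩ := covariance_local (d := d) a ha hm0 hLam
  set δ' : ℝ := min δ₁ (κ / 2) with hδ'_def
  have hδ'0 : 0 < δ' := lt_min hδ₁ (by linarith)
  have hδ'δ₁ : δ' ≤ δ₁ := min_le_left _ _
  have h2δ' : 2 * δ' ≤ κ := by have := min_le_right δ₁ (κ / 2); rw [← hδ'_def] at this; linarith
  set K : ℝ := (2 * (1 - exp (-δ'))⁻¹) ^ d with hK
  have hK0 : 0 ≤ K := pow_nonneg (mul_nonneg zero_le_two (inv_nonneg.2 (sub_nonneg.2 (exp_le_one_iff.2 (by linarith))))) d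
  set δ : ℝ := min δ' (min 1 (v₀ / (4 * d + 4))) with hδ_def
  have hδ0 : 0 < δ := lt_min hδ'0 (lt_min one_pos (by positivity))
  have hδδ' : δ ≤ δ' := min_le_left _ _
  have hδ1 : δ ≤ 1 := (min_le_right _ _).trans (min_le_left _ _)
  have hδv : δ ≤ v₀ / (4 * d + 4) := (min_le_right _ _).trans (min_le_right _ _)
  have hgap : 4 * d * δ ^ 2 ≤ v₀ := by
    have h1 : δ ^ 2 ≤ δ := by nlinarith
    have h2 : δ * (4 * d + 4) ≤ v₀ := by rwa [le_div_iff₀ (by positivity)] at hδv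
    nlinarith
  have hminv : 0 ≤ m⁻¹ := inv_nonneg.2 hm.le
  refine ⟨2 * (1 + c₁ * (m⁻¹ * exp (2 * d * κ)) * K) * (4 : ℝ) ^ d * exp (2 * d) / v₀, δ, by positivity, hδ0, ?_⟩
  intro n s _ V hV hV' ψ hψ y₀ M u f hf hfM hu x
  set T : Matrix (Site d s) (Site d s) ℝ := Matrix.of fun yy y'' : Site d s =>
    (((n : ℝ) + 1) ^ d)⁻¹ * ∑ z : Fin d → Fin (n + 1), ψ y'' (siteOf d ((n + 1) * s) (chart n (windowMap d s yy) z)) with hT_def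
  have hM : 0 ≤ M := (abs_nonneg _).trans (hfM x)
  have hVl : ∀ x, -(-v₀) ≤ V x := fun x => by linarith [hV x]
  have hTinv : ∀ y y' : Site d s, |T⁻¹ y y'| ≤ c₁ * exp (-(δ₁ * ∑ i, (((y i - y' i).valMinAbs.natAbs : ℕ) : ℝ))) :=
    fun y y' => H135 n s V hVl hV' ψ hψ y y'
  obtain ⟨-, hQ0, -⟩ := H139 n s V hVl hV' ψ hψ y₀ u f hf hu
  set cc : Site d s → ℝ := fun y' => ∑ y'', T⁻¹ y' y''
    * ((((n : ℝ) + 1) ^ d)⁻¹ * ∑ z'' : Fin d → Fin (n + 1), u (siteOf d ((n + 1) * s) (chart n (windowMap d s y'') z''))) with hcc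
  set hfl : Site d ((n + 1) * s) → ℝ := fun x => ∑ y', cc y' * ψ y' x with hhfl
  have hR := blockRMS_le_of_block_source n s y₀ f hf hfM
  have hcoef : ∀ y', |cc y'| ≤ c₁ * (m⁻¹ * exp (2 * d * κ)) * K * M * exp (-(δ' * ∑ i, (((y' i - y₀ i).valMinAbs.natAbs : ℕ) : ℝ))) := by
    intro y'
    refine (coeff_le n a s V (fun y' y'' => T⁻¹ y' y'') u ha.le hκ0.le hκ1 hm hδ'0 hδ'δ₁ h2δ' hc₁.le hVl hTinv y₀ f hf hu y').trans ?_
    have hE := exp_pos (-(δ' * ∑ i, (((y' i - y₀ i).valMinAbs.natAbs : ℕ) : ℝ)))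
    have : c₁ * (m⁻¹ * exp (2 * d * κ) * √((((n : ℝ) + 1) ^ d)⁻¹ * ∑ x, f x ^ 2)) * K ≤ c₁ * (m⁻¹ * exp (2 * d * κ) * M) * K :=
      mul_le_mul_of_nonneg_right (mul_le_mul_of_nonneg_left (mul_le_mul_of_nonneg_left hR (by positivity)) hc₁.le) hK0
    calc c₁ * (m⁻¹ * exp (2 * d * κ) * √((((n : ℝ) + 1) ^ d)⁻¹ * ∑ x, f x ^ 2)) * K
          * exp (-(δ' * ∑ i, (((y' i - y₀ i).valMinAbs.natAbs : ℕ) : ℝ)))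
        ≤ c₁ * (m⁻¹ * exp (2 * d * κ) * M) * K * exp (-(δ' * ∑ i, (((y' i - y₀ i).valMinAbs.natAbs : ℕ) : ℝ))) :=
          mul_le_mul_of_nonneg_right this hE.le
      _ = _ := by ring
  -- the displays of `u − hfl`
  have hHfl : ∀ x, ((n : ℝ) + 1) ^ 2 * ∑ μ, (2 * hfl x - hfl (x + siteOf d ((n + 1) * s) (e μ)) - hfl (x - siteOf d ((n + 1) * s) (e μ)))
      + a / ((n : ℝ) + 1) ^ d * ∑ q ∈ B n (blk n (windowMap d ((n + 1) * s) x)), hfl (siteOf d ((n + 1) * s) q) + V x * hfl x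
      = cc (siteOf d s (blk n (windowMap d ((n + 1) * s) x))) := by
    intro x
    simp only [hhfl]
    rw [SupTorusActionForm.action_sum_smul n a s Finset.univ cc ψ V x]
    simp only [hψ, mul_ite, mul_one, mul_zero, Finset.sum_ite_eq, Finset.mem_univ, if_true]
  have hdiff : ∀ x, ((n : ℝ) + 1) ^ 2 * ∑ μ, (2 * (u x - hfl x) - (u (x + siteOf d ((n + 1) * s) (e μ)) - hfl (x + siteOf d ((n + 1) * s) (e μ)))
        - (u (x - siteOf d ((n + 1) * s) (e μ)) - hfl (x - siteOf d ((n + 1) * s) (e μ))))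
      + a / ((n : ℝ) + 1) ^ d * ∑ q ∈ B n (blk n (windowMap d ((n + 1) * s) x)), (u (siteOf d ((n + 1) * s) q) - hfl (siteOf d ((n + 1) * s) q))
      + V x * (u x - hfl x) = f x - cc (siteOf d s (blk n (windowMap d ((n + 1) * s) x))) := by
    intro x; rw [SupTorusActionForm.action_sub n a s V u hfl x, hu x, hHfl x]
  -- the block term of `u − hfl` vanishes (zero block means), so `L_V(u − hfl) = f − cc∘bt`
  have hLV : ∀ x', ((n : ℝ) + 1) ^ 2 * ∑ μ, (2 * (u x' - hfl x') - (u (x' + siteOf d ((n + 1) * s) (e μ)) - hfl (x' + siteOf d ((n + 1) * s) (e μ)))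
        - (u (x' - siteOf d ((n + 1) * s) (e μ)) - hfl (x' - siteOf d ((n + 1) * s) (e μ)))) + V x' * (u x' - hfl x')
      = f x' - cc (siteOf d s (blk n (windowMap d ((n + 1) * s) x'))) := by
    intro x'
    obtain ⟨⟨y, z⟩, hyz⟩ := siteOf_chart_surjective n s x'
    simp only at hyz
    have hzero : ∑ q ∈ B n (blk n (windowMap d ((n + 1) * s) x')), (u (siteOf d ((n + 1) * s) q) - hfl (siteOf d ((n + 1) * s) q)) = 0 := by
      rw [← hyz, blockTerm_eq n s (fun x => u x - hfl x) y z]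
      have h0 := hQ0 y
      simp only [hhfl, hcc] at h0 ⊢
      have hvol : (0 : ℝ) < ((n : ℝ) + 1) ^ d := by positivity
      rcases mul_eq_zero.1 h0 with h | h
      · exact absurd h (inv_ne_zero hvol.ne')
      · exact h
    have h1 := hdiff x'
    rw [hzero, mul_zero, add_zero] at h1
    exact h1
  have hG : ∀ x', |f x' - cc (siteOf d s (blk n (windowMap d ((n + 1) * s) x')))|
      ≤ M * (1 + c₁ * (m⁻¹ * exp (2 * d * κ)) * K)
        * exp (-(δ' * ∑ i, ((((siteOf d s (blk n (windowMap d ((n + 1) * s) x'))) i - y₀ i).valMinAbs.natAbs : ℕ) : ℝ))) := by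
    intro x'
    have hE := exp_pos (-(δ' * ∑ i, ((((siteOf d s (blk n (windowMap d ((n + 1) * s) x'))) i - y₀ i).valMinAbs.natAbs : ℕ) : ℝ)))
    have hf' : |f x'| ≤ M * exp (-(δ' * ∑ i, ((((siteOf d s (blk n (windowMap d ((n + 1) * s) x'))) i - y₀ i).valMinAbs.natAbs : ℕ) : ℝ))) := by
      by_cases hx : siteOf d s (blk n (windowMap d ((n + 1) * s) x')) = y₀
      · have h0 : ∑ i, ((((siteOf d s (blk n (windowMap d ((n + 1) * s) x'))) i - y₀ i).valMinAbs.natAbs : ℕ) : ℝ) = 0 := by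
          rw [hx]; exact (SupTorusBlockDistance.isPseudoDist_torus (d := d) s).zero y₀
        rw [h0, mul_zero, neg_zero, exp_zero, mul_one]; exact hfM x'
      · rw [hf x' hx, abs_zero]; positivity
    calc |f x' - cc (siteOf d s (blk n (windowMap d ((n + 1) * s) x')))|
        ≤ |f x'| + |cc (siteOf d s (blk n (windowMap d ((n + 1) * s) x')))| := abs_sub _ _
      _ ≤ M * exp (-(δ' * ∑ i, ((((siteOf d s (blk n (windowMap d ((n + 1) * s) x'))) i - y₀ i).valMinAbs.natAbs : ℕ) : ℝ)))
          + c₁ * (m⁻¹ * exp (2 * d * κ)) * K * M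
            * exp (-(δ' * ∑ i, ((((siteOf d s (blk n (windowMap d ((n + 1) * s) x'))) i - y₀ i).valMinAbs.natAbs : ℕ) : ℝ))) :=
          add_le_add hf' (hcoef _)
      _ = _ := by ring
  have h := pointwise_decay n s hv₀ hδ0 hδ1 hδδ' hgap V hV y₀ (fun x' => u x' - hfl x')
    (fun x' => f x' - cc (siteOf d s (blk n (windowMap d ((n + 1) * s) x')))) hG hLV x
  simp only [hhfl, hcc] at h
  refine h.trans (mul_le_mul_of_nonneg_right ?_ (exp_pos _).le)
  have he : exp (2 * d * δ) ≤ exp (2 * d) := exp_le_exp.2 (by nlinarith)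
  have h0 : 0 ≤ 2 * (M * (1 + c₁ * (m⁻¹ * exp (2 * d * κ)) * K)) * (4 : ℝ) ^ d := by positivity
  rw [div_le_iff₀ hv₀]
  have e1 : 2 * (1 + c₁ * (m⁻¹ * exp (2 * d * κ)) * K) * (4 : ℝ) ^ d * exp (2 * d) / v₀ * M * v₀
      = 2 * (M * (1 + c₁ * (m⁻¹ * exp (2 * d * κ)) * K)) * (4 : ℝ) ^ d * exp (2 * d) := by field_simp
  rw [e1]
  nlinarith [mul_le_mul_of_nonneg_left he h0]

/-! ## §3. Toy -/

/-- Toy (`d = 0`, `a = v₀ = 1`): the propagator headline's hypotheses are inhabited, so the constants exist. -/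
example : ∃ C δ : ℝ, 0 < C ∧ 0 < δ := let ⟨C, δ, hC, hδ, _⟩ := propagator_pointwise_decay (d := 0) 1 one_pos (v₀ := 1) one_pos; ⟨C, δ, hC, hδ⟩

end Summit.QuantumFields.BalabanUV.T4Continuum.NE7b.SupTorusPointwiseLocality
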